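import Mathlib
import Summits.NavierStokesRegularity.NavierStokesRegularity.Theorems.TaoLadderRungTwoBreakOneShiftWindowSensGlueG
import Summits.NavierStokesRegularity.NavierStokesRegularity.Theorems.TaoLadderRungTwoBreakOneShiftWindowTailCentre
import HarnessLib

/-!
# One-shift window certificate, kernel side — part LXXIIa: THE (K2) ROW TEST OVER THE PRECONDITIONER — `KrawD.k2OK`
# (`Σ_{r'} |C_{rr'}| · Lip_{r'} ≤ S · S_r` with an UPPER Lipschitz modulus of the residual formula built from the final hull magnitudes,
# tail sensitivities, `G.hi ≥ (√eLo)⁻¹` and `|Gam| ≥ (1/(2√eLo))/eLo`) and its soundness: the two finite checks `hSb`, `hSe` of part XII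
# `K2_of_runTailSensitivity` (cell harvest/h2-tao-ladder, seat p2; rung1/RUNG1-P2G16-REPORT.md §83 (K2: hWedge); support for K1(1) =
# `NoSurvivingDSSOne`, stmt-NavierStokesRegularity-20205)

MODEL lattice only (the finite WINDOW system of a Tao-type averaged cascade); nothing here is a statement about the
Navier–Stokes equations; no item is closed; nothing numerical is asserted.

* `KrawD.hmodI`, `KrawD.resLipI`, `KrawD.k2RowOK`, **`KrawD.k2OK`** — the executable row test (wake moduli `χB` with `δT = 0` against
  `Sb`, top moduli `χE` with `δT = 1` against `Se`);
* `OneShiftFrame.resLipUp`, `resLip_le_resLipUp`, `resLip_nonneg` — the residual-formula moduli of part XII are monotone in `(√eLo)⁻¹`,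
  the rsqrt slope bound and the top-tube magnitude;
* `KrawD.mem_Sbox_of_frameMatch`, `KrawD.mem_resLipI`, `KrawD.k2_row_bound`, **`KrawD.k2_rows_of_k2OK`**;
* `rsqrt_le_of_gCert`, `rsqrtSlope_le_of_gamCert` — `(√eLo)⁻¹ ≤ G.hi`, `(1/(2√eLo))/eLo ≤ |Gam|` from the certificates of part XLIII.
-/


noncomputable section

-- the sub-problem namespace repeats the summit name by design (D-0017)
set_option linter.dupNamespace false

namespace Summit.NavierStokesRegularity.NavierStokesRegularity.Theorems

namespace DSSOneShift

open Set Finset Metric Filter Topology TopologicalSpace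
open Literature.Analysis.ODE Literature.Analysis.FluidPDE Literature.Analysis.FluidPDE.TaoCascade
open Summit.NavierStokesRegularity.NavierStokesRegularity.Theorems.TaylorModelCert
open Summit.NavierStokesRegularity.NavierStokesRegularity.Theorems.TaylorModelReadout
open Summit.NavierStokesRegularity.NavierStokesRegularity.Theorems.CertificateGlueOn

variable {m : ℕ}

/-! ### The executable row test -/

namespace KrawD

variable (k : KrawD)

/-- `H = Σ_{i<nm} 2 · A(idx1 i) · χ(idx1 i)` (the shell-1 coupling modulus of part XII `hmod`) as an interval. [folklore] -/
def hmodI (A χ : ℕ → Dyad) : IntervalD :=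
  IntervalD.rangeSumR k.rs.prec (fun i => IntervalD.mulR k.rs.prec
    (IntervalD.mulR k.rs.prec (IntervalD.ofInt 2) (IntervalD.ofDyad (A (ResSlopeD.natget k.rs.idx1 i))))
    (IntervalD.ofDyad (χ (ResSlopeD.natget k.rs.idx1 i)))) k.rs.nm

/-- **The upper Lipschitz modulus of block row `q`** (flat; `q = n` is the section row): one-shift rows
`Gs · χ(q⁺) + A(q⁺) · Γm · H`, top rows `Gs · δT + |Ttop(mode q)| · Γm · H`, section row `Σ_i A(idxD i) · χ(idxD i)`.
[cite: Tao2016AveragedNS, §5.3; cell vocabulary, harvest/h2-tao-ladder rung1/STAGE3-BANACH.md §2 ((H-lip) tail columns), rung1/RUNG1-P2G16-REPORT.md §83] -/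
def resLipI (A χ : ℕ → Dyad) (Gs Γm δT : Dyad) (q : ℕ) : IntervalD :=
  if q = k.rs.n then
    IntervalD.rangeSumR k.rs.prec (fun i => IntervalD.mulR k.rs.prec (IntervalD.ofDyad (A (ResSlopeD.natget k.rs.idxD i)))
      (IntervalD.ofDyad (χ (ResSlopeD.natget k.rs.idxD i)))) k.rs.nm
  else
    match ResSlopeD.optget k.rs.succ q with
    | some q' => IntervalD.addR k.rs.prec (IntervalD.mulR k.rs.prec (IntervalD.ofDyad Gs) (IntervalD.ofDyad (χ q')))
        (IntervalD.mulR k.rs.prec (IntervalD.mulR k.rs.prec (IntervalD.ofDyad (A q')) (IntervalD.ofDyad Γm)) (k.hmodI A χ))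
    | none => IntervalD.addR k.rs.prec (IntervalD.mulR k.rs.prec (IntervalD.ofDyad Gs) (IntervalD.ofDyad δT))
        (IntervalD.mulR k.rs.prec (IntervalD.mulR k.rs.prec
          (IntervalD.ofDyad (IntervalD.mag (IntervalD.aget k.rs.Ttop (ResSlopeD.natget k.rs.mode q)))) (IntervalD.ofDyad Γm))
          (k.hmodI A χ))

/-- Row `r` of the (K2) test: `S_r.lo > 0` and `Σ_{r'} |C_{rr'}| ⊗ resLipI_{r'} ≤ S · S_r.lo`. [cite: Tao2016AveragedNS, §5.3; cell vocabulary, harvest/h2-tao-ladder rung1/RUNG1-P2G9-REPORT.md §37 (hWedge: S_b, S_e)] -/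
def k2RowOK (A χ : ℕ → Dyad) (Gs Γm δT S : Dyad) (r : ℕ) : Bool :=
  Dyad.blt (Dyad.ofInt 0) (k.Sbox r).lo &&
  IntervalD.hiLe (IntervalD.rangeSumR k.rs.prec
    (fun r' => IntervalD.mulR k.rs.prec (IntervalD.ofDyad (k.cget r r').abs) (k.resLipI A χ Gs Γm δT r')) k.N1)
    (S.mul (k.Sbox r).lo)

/-- **THE (K2) ROW TEST**: every block row passes with the wake sensitivities `χB`, `δT = 0` against `Sb`, and with the top
sensitivities `χE`, `δT = 1` against `Se`.
[cite: Tao2016AveragedNS, §5.3; cell vocabulary, harvest/h2-tao-ladder rung1/RUNG1-P2G16-REPORT.md §83 (hWedge from Ẑ_b, Ẑ_e through C)] -/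
def k2OK (A χB χE : ℕ → Dyad) (Gs Γm Sb Se : Dyad) : Bool :=
  (List.range k.N1).all fun r =>
    k.k2RowOK A χB Gs Γm (Dyad.ofInt 0) Sb r && k.k2RowOK A χE Gs Γm (Dyad.ofInt 1) Se r

end KrawD

/-! ### The residual-formula moduli are monotone -/

namespace OneShiftFrame

variable (F : OneShiftFrame m)

/-- The moduli of part XII `resLip` with the two irrational constants replaced by upper bounds `Gs ≥ (√eLo)⁻¹`,
`Γm ≥ (1/(2√eLo))/eLo`. [folklore] -/
def resLipUp (Gs Γm : ℝ) (A : Fin m → ℤ → ℝ) (TW : Fin m → ℝ) (δz : Fin m → ℤ → ℝ) (δT : ℝ) : F.WIdx → ℝ :=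
  fun r =>
    match r with
    | some (i, j) =>
        if ((j : ℕ) : ℤ) + 1 < F.W then Gs * δz i (((j : ℕ) : ℤ) + 1) + A i (((j : ℕ) : ℤ) + 1) * Γm * hmod A δz
        else Gs * δT + TW i * Γm * hmod A δz
    | none => ∑ i, A i F.D * δz i F.D

/-- **`resLip ≤ resLipUp`** for non-negative data, larger constants and larger top-tube magnitudes. [folklore] -/
theorem resLip_le_resLipUp {eLo Gs Γm : ℝ} (heLo : 0 < eLo) (hGs : (Real.sqrt eLo)⁻¹ ≤ Gs) (hΓ : (1 / (2 * Real.sqrt eLo)) / eLo ≤ Γm)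
    {A δz : Fin m → ℤ → ℝ} {TW TW' : Fin m → ℝ} {δT : ℝ} (hA : ∀ i k, 0 ≤ A i k) (hδz : ∀ i k, 0 ≤ δz i k)
    (hTW : ∀ i, 0 ≤ TW i) (hTW' : ∀ i, TW i ≤ TW' i) (hδT : 0 ≤ δT) (r : F.WIdx) :
    F.resLip A eLo TW δz δT r ≤ F.resLipUp Gs Γm A TW' δz δT r := by
  have hg0 : 0 ≤ (Real.sqrt eLo)⁻¹ := inv_nonneg.2 (Real.sqrt_nonneg _)
  have hγ0 : 0 ≤ (1 / (2 * Real.sqrt eLo)) / eLo := by positivity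
  have hH : 0 ≤ hmod A δz := Finset.sum_nonneg fun i _ => mul_nonneg (mul_nonneg (by norm_num) (hA i 1)) (hδz i 1)
  rcases r with _ | ⟨i, j⟩
  · simp only [resLip, resLipUp]; exact le_rfl
  · by_cases hj : ((j : ℕ) : ℤ) + 1 < F.W
    · simp only [resLip, resLipUp, if_pos hj]
      have h1 : (Real.sqrt eLo)⁻¹ * δz i (((j : ℕ) : ℤ) + 1) ≤ Gs * δz i (((j : ℕ) : ℤ) + 1) :=
        mul_le_mul_of_nonneg_right hGs (hδz _ _)
      have h2 : A i (((j : ℕ) : ℤ) + 1) * ((1 / (2 * Real.sqrt eLo)) / eLo) * hmod A δz ≤ A i (((j : ℕ) : ℤ) + 1) * Γm * hmod A δz :=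
        mul_le_mul_of_nonneg_right (mul_le_mul_of_nonneg_left hΓ (hA _ _)) hH
      linarith
    · simp only [resLip, resLipUp, if_neg hj]
      have h1 : (Real.sqrt eLo)⁻¹ * δT ≤ Gs * δT := mul_le_mul_of_nonneg_right hGs hδT
      have h2 : TW i * ((1 / (2 * Real.sqrt eLo)) / eLo) * hmod A δz ≤ TW' i * Γm * hmod A δz := by
        refine mul_le_mul_of_nonneg_right ?_ hH
        exact mul_le_mul (hTW' i) hΓ hγ0 ((hTW i).trans (hTW' i))
      linarith

/-- `resLip` is non-negative for non-negative data. [folklore] -/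
theorem resLip_nonneg {eLo : ℝ} (heLo : 0 < eLo) {A δz : Fin m → ℤ → ℝ} {TW : Fin m → ℝ} {δT : ℝ}
    (hA : ∀ i k, 0 ≤ A i k) (hδz : ∀ i k, 0 ≤ δz i k) (hTW : ∀ i, 0 ≤ TW i) (hδT : 0 ≤ δT) (r : F.WIdx) :
    0 ≤ F.resLip A eLo TW δz δT r := by
  have hg0 : 0 ≤ (Real.sqrt eLo)⁻¹ := inv_nonneg.2 (Real.sqrt_nonneg _)
  have hγ0 : 0 ≤ (1 / (2 * Real.sqrt eLo)) / eLo := by positivity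
  have hH : 0 ≤ hmod A δz := Finset.sum_nonneg fun i _ => mul_nonneg (mul_nonneg (by norm_num) (hA i 1)) (hδz i 1)
  rcases r with _ | ⟨i, j⟩
  · simp only [resLip]; exact Finset.sum_nonneg fun i _ => mul_nonneg (hA _ _) (hδz _ _)
  · by_cases hj : ((j : ℕ) : ℤ) + 1 < F.W
    · simp only [resLip, if_pos hj]
      exact add_nonneg (mul_nonneg hg0 (hδz _ _)) (mul_nonneg (mul_nonneg (hA _ _) hγ0) hH)
    · simp only [resLip, if_neg hj]
      exact add_nonneg (mul_nonneg hg0 hδT) (mul_nonneg (mul_nonneg (hTW _) hγ0) hH)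

end OneShiftFrame

/-! ### Soundness of the row test -/

namespace KrawD

variable (k : KrawD) {F : OneShiftFrame m} (e : Fin m × Fin F.W ≃ Fin k.rs.n)

section RowsSound

variable {g : GridD} {kd' : KrawD} {e' : F.SIdx ≃ Fin g.n} {R : ℤ → ℝ}

/-- The block scale lies in its box (from the frame-matching facts). [folklore] -/
theorem mem_Sbox_of_frameMatch (M : F.FrameMatch g k e' R) (he : ∀ p : F.SIdx, (e p : ℕ) = (e' p : ℕ)) (r : F.WIdx) :
    IntervalD.mem (F.bscale r) (k.Sbox (k.rs.eO F e r)) := by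
  rcases r with _ | ⟨i, j⟩
  · simp only [OneShiftFrame.bscale, Option.elim, Sbox, ResSlopeD.eO, if_true]; exact M.hrτ
  · simp only [OneShiftFrame.bscale, Option.elim, Sbox, ResSlopeD.eO]
    rw [if_neg (e (i, j)).isLt.ne, he]
    exact M.ha i j

/-- **The upper moduli read from dyadics lie in `resLipI`.** `A`, `χ` are read at flat indices through `e`;
`TW' i = |Ttop i|`. [folklore] -/
theorem mem_resLipI (M : F.FrameMatch g k e' R) (he : ∀ p : F.SIdx, (e p : ℕ) = (e' p : ℕ)) (Am χD : ℕ → Dyad)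
    (Gs Γm δT : Dyad) (r : F.WIdx) :
    IntervalD.mem
      (F.resLipUp Gs.toReal Γm.toReal
        (fun i k => if h : F.InWindow k then (Am (e (i, F.widx h))).toReal else 0)
        (fun i => (IntervalD.mag (IntervalD.aget k.rs.Ttop i)).toReal)
        (fun i k => if h : F.InWindow k then (χD (e (i, F.widx h))).toReal else 0) δT.toReal r)
      (k.resLipI Am χD Gs Γm δT (k.rs.eO F e r)) := by
  classical
  have hW1 := M.hW1
  have hDW := M.hDW
  have hin1 : F.InWindow 1 := ⟨by norm_num, by exact_mod_cast hW1⟩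
  have hinD : F.InWindow F.D := ⟨by positivity, by exact_mod_cast hDW⟩
  have hw1 : F.widx hin1 = ⟨1, hW1⟩ := Fin.ext (by simp [OneShiftFrame.widx])
  have hwD : F.widx hinD = ⟨F.D, hDW⟩ := Fin.ext (by simp [OneShiftFrame.widx])
  -- the shell-1 coupling modulus
  have hH : IntervalD.mem (OneShiftFrame.hmod (fun i k => if h : F.InWindow k then (Am (e (i, F.widx h))).toReal else 0)
      (fun i k => if h : F.InWindow k then (χD (e (i, F.widx h))).toReal else 0)) (k.hmodI Am χD) := by
    unfold OneShiftFrame.hmod KrawD.hmodI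
    rw [M.hm]
    refine mem_sum_equiv (Equiv.refl (Fin m)) k.rs.prec fun i hi => ?_
    simp only [Equiv.refl_symm, Equiv.refl_apply, dif_pos hin1, hw1]
    have h1 := M.hidx1 ⟨i, hi⟩
    rw [← he] at h1
    rw [h1]
    exact IntervalD.mem_mulR k.rs.prec (IntervalD.mem_mulR k.rs.prec (by exact_mod_cast IntervalD.mem_ofInt 2) (IntervalD.mem_ofDyad _))
      (IntervalD.mem_ofDyad _)
  rcases r with _ | ⟨i, j⟩
  · -- section row
    simp only [OneShiftFrame.resLipUp, ResSlopeD.eO, Option.elim, KrawD.resLipI, if_true]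
    rw [M.hm]
    refine mem_sum_equiv (Equiv.refl (Fin m)) k.rs.prec fun i' hi' => ?_
    simp only [Equiv.refl_symm, Equiv.refl_apply, dif_pos hinD, hwD]
    have h1 := M.hidxD ⟨i', hi'⟩
    rw [← he] at h1
    rw [h1]
    exact IntervalD.mem_mulR k.rs.prec (IntervalD.mem_ofDyad _) (IntervalD.mem_ofDyad _)
  · simp only [OneShiftFrame.resLipUp, ResSlopeD.eO, Option.elim, KrawD.resLipI]
    rw [if_neg (e (i, j)).isLt.ne]
    have hs := M.hsucc i j
    rw [← he] at hs
    by_cases hj : ((j : ℕ) : ℤ) + 1 < F.W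
    · have hj' : (j : ℕ) + 1 < F.W := by exact_mod_cast hj
      rw [dif_pos hj'] at hs
      simp only [← he] at hs
      rw [hs, if_pos hj]
      have hin : F.InWindow (((j : ℕ) : ℤ) + 1) := ⟨by positivity, hj⟩
      have hwj : F.widx hin = ⟨(j : ℕ) + 1, hj'⟩ := Fin.ext (by simp [OneShiftFrame.widx])
      simp only [dif_pos hin, hwj]
      exact IntervalD.mem_addR k.rs.prec (IntervalD.mem_mulR k.rs.prec (IntervalD.mem_ofDyad _) (IntervalD.mem_ofDyad _))
        (IntervalD.mem_mulR k.rs.prec (IntervalD.mem_mulR k.rs.prec (IntervalD.mem_ofDyad _) (IntervalD.mem_ofDyad _)) hH)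
    · have hj' : ¬ (j : ℕ) + 1 < F.W := fun h => hj (by exact_mod_cast h)
      rw [dif_neg hj'] at hs
      rw [hs, if_neg hj]
      have hmode := M.hmode i j
      rw [← he] at hmode
      simp only [hmode]
      exact IntervalD.mem_addR k.rs.prec (IntervalD.mem_mulR k.rs.prec (IntervalD.mem_ofDyad _) (IntervalD.mem_ofDyad _))
        (IntervalD.mem_mulR k.rs.prec (IntervalD.mem_mulR k.rs.prec (IntervalD.mem_ofDyad _) (IntervalD.mem_ofDyad _)) hH)

/-- One `δT` of the row test: if every block row passes against `S`, the finite check of part XII holds with `S`. [folklore] -/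
theorem k2_row_bound (M : F.FrameMatch g k e' R) (he : ∀ p : F.SIdx, (e p : ℕ) = (e' p : ℕ)) (Am χD : ℕ → Dyad)
    (hAm : ∀ p : F.SIdx, 0 ≤ (Am (e p)).toReal) (hχD : ∀ p : F.SIdx, 0 ≤ (χD (e p)).toReal)
    {Gs Γm δT S : Dyad} {eLo : ℝ} (heLo : 0 < eLo) (hGs : (Real.sqrt eLo)⁻¹ ≤ Gs.toReal)
    (hΓ : (1 / (2 * Real.sqrt eLo)) / eLo ≤ Γm.toReal) (hδT : 0 ≤ δT.toReal)
    (hrow : ∀ r < k.N1, k.k2RowOK Am χD Gs Γm δT S r = true) :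
    ∀ r, (∑ r', |k.CmatR F e r r'| *
      F.resLip (fun i k => if h : F.InWindow k then (Am (e (i, F.widx h))).toReal else 0) eLo
        (fun i => |F.tubeC i F.W| + F.tubeR F.W)
        (fun i k => if h : F.InWindow k then (χD (e (i, F.widx h))).toReal else 0) δT.toReal r') / F.bscale r ≤ S.toReal := by
  classical
  -- the top tube lies inside `|Ttop|`
  have hTW0 : ∀ i, 0 ≤ |F.tubeC i F.W| + F.tubeR F.W := fun i => add_nonneg (abs_nonneg _) (F.tubeR_nonneg _)
  have hTW : ∀ i, |F.tubeC i F.W| + F.tubeR F.W ≤ (IntervalD.mag (IntervalD.aget k.rs.Ttop i)).toReal := by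
    intro i
    have hp := M.hTtop i (F.tubeC i F.W + F.tubeR F.W) (by rw [add_sub_cancel_left, abs_of_nonneg (F.tubeR_nonneg _)])
    have hm := M.hTtop i (F.tubeC i F.W - F.tubeR F.W) (by
      rw [show F.tubeC i F.W - F.tubeR F.W - F.tubeC i F.W = -F.tubeR F.W by ring, abs_neg, abs_of_nonneg (F.tubeR_nonneg _)])
    have h1 := IntervalD.abs_le_mag hp
    have h2 := IntervalD.abs_le_mag hm
    rcases le_or_gt 0 (F.tubeC i F.W) with hc | hc
    · rw [abs_of_nonneg hc]
      exact (le_abs_self _).trans h1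
    · rw [abs_of_neg hc]
      have : -F.tubeC i F.W + F.tubeR F.W = -(F.tubeC i F.W - F.tubeR F.W) := by ring
      rw [this]
      exact (neg_le_abs _).trans h2
  have hA0 : ∀ i kk, 0 ≤ (fun i kk => if h : F.InWindow kk then (Am (e (i, F.widx h))).toReal else 0) i kk := fun i kk => by
    dsimp only; split_ifs <;> [exact hAm _; exact le_rfl]
  have hχ0 : ∀ i kk, 0 ≤ (fun i kk => if h : F.InWindow kk then (χD (e (i, F.widx h))).toReal else 0) i kk := fun i kk => by
    dsimp only; split_ifs <;> [exact hχD _; exact le_rfl]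
  intro r
  have hr := (k.eOE F e r).isLt
  rw [eOE_val] at hr
  have h := hrow _ hr
  unfold k2RowOK at h
  simp only [Bool.and_eq_true] at h
  obtain ⟨hSlo, hle⟩ := h
  have hSlo' : 0 < (k.Sbox (k.rs.eO F e r)).lo.toReal := by simpa using (Dyad.blt_iff _ _).1 hSlo
  have hS := F.bscale_pos r
  have hSmem := k.mem_Sbox_of_frameMatch e M he r
  -- the real row sum with the UPPER moduli lies in the interval row sum
  have hm : IntervalD.mem (∑ r' : F.WIdx, |k.CmatR F e r r'| *
      F.resLipUp Gs.toReal Γm.toReal (fun i k => if h : F.InWindow k then (Am (e (i, F.widx h))).toReal else 0)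
        (fun i => (IntervalD.mag (IntervalD.aget k.rs.Ttop i)).toReal)
        (fun i k => if h : F.InWindow k then (χD (e (i, F.widx h))).toReal else 0) δT.toReal r')
      (IntervalD.rangeSumR k.rs.prec
        (fun r' => IntervalD.mulR k.rs.prec (IntervalD.ofDyad (k.cget (k.rs.eO F e r) r').abs) (k.resLipI Am χD Gs Γm δT r')) k.N1) := by
    have hN1 : k.N1 = k.rs.n + 1 := rfl
    rw [hN1]
    refine mem_sum_equiv (k.eOE F e) k.rs.prec fun j hj => ?_
    have hval : k.rs.eO F e ((k.eOE F e).symm ⟨j, hj⟩) = j := by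
      have := k.eOE_val F e ((k.eOE F e).symm ⟨j, hj⟩)
      rw [Equiv.apply_symm_apply] at this
      exact this.symm
    have hmr := k.mem_resLipI e M he Am χD Gs Γm δT ((k.eOE F e).symm ⟨j, hj⟩)
    rw [hval] at hmr
    unfold CmatR
    rw [hval, ← Dyad.toReal_abs]
    exact IntervalD.mem_mulR k.rs.prec (IntervalD.mem_ofDyad _) hmr
  have hup := IntervalD.le_of_hiLe hle hm
  rw [Dyad.toReal_mul] at hup
  -- compare `resLip ≤ resLipUp` termwise
  have hcmp : ∑ r' : F.WIdx, |k.CmatR F e r r'| *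
      F.resLip (fun i k => if h : F.InWindow k then (Am (e (i, F.widx h))).toReal else 0) eLo
        (fun i => |F.tubeC i F.W| + F.tubeR F.W)
        (fun i k => if h : F.InWindow k then (χD (e (i, F.widx h))).toReal else 0) δT.toReal r' ≤
      ∑ r' : F.WIdx, |k.CmatR F e r r'| *
      F.resLipUp Gs.toReal Γm.toReal (fun i k => if h : F.InWindow k then (Am (e (i, F.widx h))).toReal else 0)
        (fun i => (IntervalD.mag (IntervalD.aget k.rs.Ttop i)).toReal)
        (fun i k => if h : F.InWindow k then (χD (e (i, F.widx h))).toReal else 0) δT.toReal r' :=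
    Finset.sum_le_sum fun r' _ => mul_le_mul_of_nonneg_left
      (F.resLip_le_resLipUp heLo hGs hΓ hA0 hχ0 hTW0 hTW hδT r') (abs_nonneg _)
  rw [div_le_iff₀ hS]
  refine hcmp.trans (hup.trans ?_)
  -- `S ≥ 0`: a non-negative sum is `≤ S · Slo` with `Slo > 0`
  have hnn : 0 ≤ ∑ r' : F.WIdx, |k.CmatR F e r r'| *
      F.resLip (fun i k => if h : F.InWindow k then (Am (e (i, F.widx h))).toReal else 0) eLo
        (fun i => |F.tubeC i F.W| + F.tubeR F.W)
        (fun i k => if h : F.InWindow k then (χD (e (i, F.widx h))).toReal else 0) δT.toReal r' :=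
    Finset.sum_nonneg fun r' _ => mul_nonneg (abs_nonneg _) (F.resLip_nonneg heLo hA0 hχ0 hTW0 hδT r')
  have hS0 : 0 ≤ S.toReal := by
    have h1 := hnn.trans (hcmp.trans hup)
    by_contra hneg
    have hneg' : S.toReal < 0 := lt_of_not_ge hneg
    have : S.toReal * (k.Sbox (k.rs.eO F e r)).lo.toReal < 0 := mul_neg_of_neg_of_pos hneg' hSlo'
    linarith
  exact mul_le_mul_of_nonneg_left hSmem.1 hS0

/-- **THE TWO FINITE CHECKS OF PART XII FROM THE ROW TEST.** With `A`, `χB`, `χE` read from dyadics at flat indices, `eLo > 0`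
with `(√eLo)⁻¹ ≤ Gs`, `(1/(2√eLo))/eLo ≤ Γm`, and the top tube inside `Ttop`: `k2OK` gives `hSb` (with `χB`) and `hSe` (with `χE`)
of `K2_of_runTailSensitivity` for the preconditioner `CmatR`. [cite: Tao2016AveragedNS, §5.3; cell vocabulary, harvest/h2-tao-ladder rung1/RUNG1-P2G9-REPORT.md §37 (S_b, S_e), rung1/RUNG1-P2G16-REPORT.md §83] -/
theorem k2_rows_of_k2OK (M : F.FrameMatch g k e' R) (he : ∀ p : F.SIdx, (e p : ℕ) = (e' p : ℕ)) (Am χB χE : ℕ → Dyad)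
    (hAm : ∀ p : F.SIdx, 0 ≤ (Am (e p)).toReal) (hχB : ∀ p : F.SIdx, 0 ≤ (χB (e p)).toReal)
    (hχE : ∀ p : F.SIdx, 0 ≤ (χE (e p)).toReal)
    {Gs Γm Sb Se : Dyad} {eLo : ℝ} (heLo : 0 < eLo) (hGs : (Real.sqrt eLo)⁻¹ ≤ Gs.toReal)
    (hΓ : (1 / (2 * Real.sqrt eLo)) / eLo ≤ Γm.toReal) (hk2 : k.k2OK Am χB χE Gs Γm Sb Se = true) :
    (∀ r, (∑ r', |k.CmatR F e r r'| *
      F.resLip (fun i k => if h : F.InWindow k then (Am (e (i, F.widx h))).toReal else 0) eLo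
        (fun i => |F.tubeC i F.W| + F.tubeR F.W)
        (fun i k => if h : F.InWindow k then (χB (e (i, F.widx h))).toReal else 0) 0 r') / F.bscale r ≤ Sb.toReal) ∧
    (∀ r, (∑ r', |k.CmatR F e r r'| *
      F.resLip (fun i k => if h : F.InWindow k then (Am (e (i, F.widx h))).toReal else 0) eLo
        (fun i => |F.tubeC i F.W| + F.tubeR F.W)
        (fun i k => if h : F.InWindow k then (χE (e (i, F.widx h))).toReal else 0) 1 r') / F.bscale r ≤ Se.toReal) := by
  have hrows : ∀ r < k.N1, k.k2RowOK Am χB Gs Γm (Dyad.ofInt 0) Sb r = true ∧ k.k2RowOK Am χE Gs Γm (Dyad.ofInt 1) Se r = true := by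
    unfold k2OK at hk2
    simpa [List.all_eq_true, List.mem_range, Bool.and_eq_true] using hk2
  refine ⟨fun r => ?_, fun r => ?_⟩
  · have h := k.k2_row_bound e M he Am χB hAm hχB heLo hGs hΓ (δT := Dyad.ofInt 0) (by simp) (fun r hr => (hrows r hr).1) r
    simpa using h
  · have h := k.k2_row_bound e M he Am χE hAm hχE heLo hGs hΓ (δT := Dyad.ofInt 1) (by simp) (fun r hr => (hrows r hr).2) r
    simpa using h

end RowsSound

end KrawD

/-! ### The two irrational constants from the range certificates -/

/-- `(√eLo)⁻¹ ≤ G.hi` from the square test of part XLIII. [folklore] -/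
theorem rsqrt_le_of_gCert {eLo eHi : Dyad} {G : IntervalD} (h : gCert eLo eHi G = true) (heLo : 0 < eLo.toReal)
    (hle : eLo.toReal ≤ eHi.toReal) : (Real.sqrt eLo.toReal)⁻¹ ≤ G.hi.toReal :=
  (mem_rsqrt_of_gCert h heLo ⟨le_rfl, hle⟩).2

/-- `(1/(2√eLo))/eLo ≤ |Gam|` from the cube test of part XLIII (the rsqrt slope at `eLo` lies in `Gam`). [folklore] -/
theorem rsqrtSlope_le_of_gamCert {eLo eHi : Dyad} {Gam : IntervalD} (h : gamCert eLo eHi Gam = true) (heLo : 0 < eLo.toReal)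
    (hle : eLo.toReal ≤ eHi.toReal) : (1 / (2 * Real.sqrt eLo.toReal)) / eLo.toReal ≤ (IntervalD.mag Gam).toReal := by
  have hmem := mem_rsqrtDeriv_of_gamCert h heLo ⟨le_rfl, hle⟩
  have habs := IntervalD.abs_le_mag hmem
  have e1 : rsqrtDeriv eLo.toReal = -((1 / (2 * Real.sqrt eLo.toReal)) / eLo.toReal) := by
    rw [rsqrtDeriv, Real.sq_sqrt heLo.le]; ring
  rw [e1, abs_neg, abs_of_nonneg (by positivity)] at habs
  exact habs

end DSSOneShift

end Summit.NavierStokesRegularity.NavierStokesRegularity.Theorems
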